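import Summits.BirchSwinnertonDyer.BirchSwinnertonDyer.Theorems.ThetaPartnerAtTwoSignedTransportAtTwoSharpCoinvOfPrint
import HarnessLib

/-!
# Invariant families of local classes are realised over `ℚ`: the «fixed points are hit» input of SURJ♯ at `2`

Route `ThetaPartnerAtTwo` (TP2), crux K1 `SignedTransportAtTwo` (stmt-BirchSwinnertonDyer-20333), line `bridge` v23, registered research
stub `stub_surj2` (GV Prop. (2.1) READ AT `2`, signed). Seat `prover-bsd-wall-tp2-p3-w2` (K4 width seat 2/3, g3), serving K1. This file is
the «`F^Γ ⊆ I`» input of the engine `…SignedTransportAtTwoSurjEngine` (the sequel `…SharpSurjOfPrint` assembles SURJ♯):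
* §1 two elementary tools (`exists_uniform_nat`: uniform index for finitely many monotone eventually-true predicates;
  `conjH1_pow_eq_self`);
* §2 `exists_mem_sharp_localRes_eq_of_invariant` — a family `(c_v)_{v ∈ S₀}` of `Γ_{ℚ_v}`-INVARIANT `2`-power-torsion classes
  `c_v ∈ 𝒫_v = H¹(Gal(ℚ̄_v/(ℚ_∞)_η), E(ℚ̄_v))` is `(loc_v(conj_{γⁿ} s))` for ONE `s ∈ Sel♯_{S₀}(E/ℚ_∞)` restricted from `ℚ` (all `n`):
  Cassels' theorem over `ℚ` (PUB `casselsSurjectivity_H1Sigma ℚ`; `E(ℚ)[2] = 0` on the row, `Sel_{2^∞}(W/ℚ)` finite) with the local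
  prescriptions `Greenberg1999.localQuotient_restriction_surjective_holds` (p. 108, tree theorem) at `v ∈ S₀` and LOC⁺@2
  (`plusLocKummer_two`, `t = 0`) above `2`.

HONEST FRAMING: THEOREMS ONLY (no definition, no named fact, no `sorry`); conditional on the PRINTED-but-unproved Cassels/Greenberg fact
taken as hypothesis; closes no item; BSD is not proved by any of this.

References: [GreenbergLNM1716] §4 Lemma 4.7 (pp. 107–108), Prop. 4.13, p. 122; [GreenbergVatsal2000] §2 Prop. (2.1) (p. 23).
-/

set_option autoImplicit false
-- the Theorems namespace of this sub repeats the summit name by design (D-0017 nested layout)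
set_option linter.dupNamespace false

noncomputable section

open scoped Classical NumberField

open NumberField IsDedekindDomain

namespace Summit.BirchSwinnertonDyer.BirchSwinnertonDyer.Theorems.SignedEC

open Literature.NumberTheory.EllipticCurves Literature.NumberTheory.GaloisRepresentations
  WeierstrassCurve ZpExtension Literature.NumberTheory.EllipticCurves.Kobayashi2003
  Literature.NumberTheory.EllipticCurves.IwasawaDual Literature.NumberTheory.EllipticCurves.IwasawaAlgebra
  Literature.NumberTheory.EllipticCurves.GreenbergVatsal2000 Literature.NumberTheory.EllipticCurves.Rank1Residual
  Literature.NumberTheory.EllipticCurves.Sprung2012 Summit.BirchSwinnertonDyer.Rank1Residual.Additive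

/-! ## §1. Two elementary tools -/

/-- A finite family of eventually-true monotone predicates is uniformly true from some index on. [folklore] -/
theorem exists_uniform_nat {ι : Type*} [Fintype ι] (N : ι → ℕ) (P : ι → ℕ → ℕ → Prop)
    (hmono : ∀ i n k k', k ≤ k' → P i n k → P i n k') (h : ∀ i, ∀ n < N i, ∃ k, P i n k) :
    ∃ K, ∀ i, ∀ n < N i, P i n K := by
  let k : ι → ℕ → ℕ := fun i n ↦ if hn : n < N i then Classical.choose (h i n hn) else 0
  have hk : ∀ i, ∀ n < N i, P i n (k i n) := fun i n hn ↦ by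
    simp only [k, dif_pos hn]
    exact Classical.choose_spec (h i n hn)
  refine ⟨Finset.univ.sup fun i ↦ (Finset.range (N i)).sup (k i), fun i n hn ↦ hmono i n (k i n) _ ?_ (hk i n hn)⟩
  exact (Finset.le_sup (f := k i) (Finset.mem_range.mpr hn)).trans
    (Finset.le_sup (f := fun i ↦ (Finset.range (N i)).sup (k i)) (Finset.mem_univ i))

universe u in
/-- If `conj_a` fixes a class, so does `conj_{a^m}`. [folklore] -/
theorem conjH1_pow_eq_self {G : Type u} [Group G] [TopologicalSpace G] [IsTopologicalGroup G]
    (H : Subgroup G) [H.Normal] (M : Type u) [AddCommGroup M] [DistribMulAction G M] [TopologicalSpace M]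
    [DiscreteTopology M] {a : G} {c : subgroupH1 H M}
    (hc : Literature.NumberTheory.EllipticCurves.conjH1 H M a c = c) (m : ℕ) :
    Literature.NumberTheory.EllipticCurves.conjH1 H M (a ^ m) c = c := by
  induction m with
  | zero =>
    rw [pow_zero, Literature.NumberTheory.EllipticCurves.conjH1_one_holds H M, AddMonoidHom.id_apply]
  | succ m ih =>
    rw [pow_succ, Literature.NumberTheory.EllipticCurves.conjH1_mul_holds H M, AddMonoidHom.comp_apply, hc, ih]

variable (W : WeierstrassCurve ℚ) [W.IsElliptic] [W.IsGloballyMinimal]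

/-! ## §2. Constant invariant families are realised over `ℚ` (Cassels + the local lifts) -/

/-- **A family of `Γ_{ℚ_v}`-invariant `2`-power-torsion local classes `(c_v)_{v ∈ S₀}` is the localisation of ONE class of
`Sel♯_{S₀}` restricted from `ℚ`** (so all its `γ`-translates have the same localisations): Cassels' theorem (PUB, `E(ℚ)[2] = 0` on the row,
`Sel_{2^∞}(W/ℚ)` finite) with the local prescriptions `localQuotient_restriction_surjective_holds` (Greenberg p. 108) at `v ∈ S₀` and
LOC⁺@2 (`plusLocKummer_two` for `t = 0`) above `2`. [cite: GreenbergLNM1716, §4 Lemma 4.7 (pp. 107–108), p. 122 (Cassels)]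
[cite: GreenbergVatsal2000, §2 Prop. (2.1)] -/
theorem exists_mem_sharp_localRes_eq_of_invariant (hC : Greenberg1999.casselsSurjectivity_H1Sigma ℚ)
    (hss : GoodSS W 2) (ha : W.frobeniusTrace 2 = 0) {κ : ZpExtension ℚ 2} (hκ : κ.IsCyclotomic)
    (γ : Field.absoluteGaloisGroup ℚ)
    (S₀ : Finset (HeightOneSpectrum (𝓞 ℚ))) (hS₀ : ∀ v ∈ S₀, ((2 : ℕ) : 𝓞 ℚ) ∉ v.asIdeal)
    (hS : ∀ v : HeightOneSpectrum (𝓞 ℚ), ¬ W.HasGoodReductionAt v → v ∈ S₀) (hSel : Finite (W.selmerGroupPInfty 2))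
    (c : ∀ v : ↥S₀, discreteH1 (localSubgroup κ.kerSubgroup (v.1.adicCompletion ℚ)) (localPoints W (v.1.adicCompletion ℚ)))
    (hctor : ∀ v : ↥S₀, ∃ k : ℕ, 2 ^ k • c v = 0)
    (hcinv : ∀ (v : ↥S₀) (δ : Field.absoluteGaloisGroup (v.1.adicCompletion ℚ)),
      Literature.NumberTheory.EllipticCurves.conjH1 (localSubgroup κ.kerSubgroup (v.1.adicCompletion ℚ))
        (localPoints W (v.1.adicCompletion ℚ)) δ (c v) = c v) :
    ∃ s ∈ unramifiedOutside κ.kerSubgroup ↥(W.geomPrimaryTorsion 2) 2 (↑S₀ : Set (HeightOneSpectrum (𝓞 ℚ))) ⊓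
        ⨅ (v : HeightOneSpectrum (𝓞 ℚ)) (_ : ((2 : ℕ) : 𝓞 ℚ) ∈ v.asIdeal) (σ : Field.absoluteGaloisGroup ℚ),
          (localKummerOverOfEmb W 2 κ.kerSubgroup (closureEmb (K := ℚ) (v.adicCompletion ℚ))
            (⨆ n : ℕ, signedLocalPoints κ (v.adicCompletion ℚ) W 1 n)).comap (W.conjH1 2 κ.kerSubgroup σ),
      ∀ (v : ↥S₀) (n : ℕ), W.localResOver 2 κ.kerSubgroup (v.1.adicCompletion ℚ) (W.conjH1 2 κ.kerSubgroup (γ ^ n) s) = c v := by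
  -- `E(ℚ)[2] = 0`
  have hirr := (Summit.BirchSwinnertonDyer.Rank1Residual.X5.O1.irr_two_iff_forall_two_nsmul W).mp
    (Summit.BirchSwinnertonDyer.Rank1Residual.P2.irr_two_of_goodSS_two W hss)
  have hE : Nat.card (MulAction.fixedPoints (Field.absoluteGaloisGroup ℚ) (W.geomPrimaryTorsion 2)) = 1 := by
    refine W.natCard_fixedPoints_absoluteGaloisGroup_geomPrimaryTorsion_eq_one (p := 2) fun Q hQ ↦ ?_
    apply hirr Q
    convert hQ
  have hgood : ∀ v : HeightOneSpectrum (𝓞 ℚ), v ∉ (↑S₀ : Set (HeightOneSpectrum (𝓞 ℚ))) →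
      ((2 : ℕ) : 𝓞 ℚ) ∉ v.asIdeal → W.HasGoodReductionAt v := by
    intro v hv _
    by_contra hng
    exact hv (Finset.mem_coe.mpr (hS v hng))
  -- local lifts: at `v ∈ S₀` Greenberg's p. 108 (tree theorem), above `2` LOC⁺@2 for `t = 0`
  have hlocS : ∀ v : HeightOneSpectrum (𝓞 ℚ), ∃ xv : discreteH1 (localSubgroup (⊤ : Subgroup (Field.absoluteGaloisGroup ℚ))
      (v.adicCompletion ℚ)) (localPoints W (v.adicCompletion ℚ)), (∃ k : ℕ, 2 ^ k • xv = 0) ∧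
      ∀ hv : v ∈ S₀, Literature.NumberTheory.EllipticCurves.resOfLe (localPoints W (v.adicCompletion ℚ))
        (Subgroup.comap_mono le_top : localSubgroup κ.kerSubgroup (v.adicCompletion ℚ) ≤
          localSubgroup (⊤ : Subgroup (Field.absoluteGaloisGroup ℚ)) (v.adicCompletion ℚ)) xv = c ⟨v, hv⟩ := by
    intro v
    by_cases hv : v ∈ S₀
    · obtain ⟨xv, hxv, hres⟩ := Greenberg1999.localQuotient_restriction_surjective_holds W 2 κ hκ v (hS₀ v hv)
        (c ⟨v, hv⟩) (hctor ⟨v, hv⟩) (hcinv ⟨v, hv⟩)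
      exact ⟨xv, hxv, fun _ ↦ hres⟩
    · exact ⟨0, ⟨0, smul_zero _⟩, fun h ↦ absurd h hv⟩
  choose xS hxS_tor hxS using hlocS
  have hloc2 : ∀ w : HeightOneSpectrum (𝓞 ℚ), ((2 : ℕ) : 𝓞 ℚ) ∈ w.asIdeal →
      ∃ xw : discreteH1 (localSubgroup (⊤ : Subgroup (Field.absoluteGaloisGroup ℚ)) (w.adicCompletion ℚ))
          (localPoints W (w.adicCompletion ℚ)),
        (∃ k : ℕ, 2 ^ k • xw = 0) ∧
        ∀ y' : W.subgroupH1 2 (⊤ : Subgroup (Field.absoluteGaloisGroup ℚ)),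
          W.localResOver 2 ⊤ (w.adicCompletion ℚ) y' = xw →
          (0 : W.subgroupH1 2 κ.kerSubgroup) - W.resOfLe 2 (le_top : κ.kerSubgroup ≤ ⊤) y' ∈
            localKummerOverOfEmb W 2 κ.kerSubgroup (closureEmb (K := ℚ) (w.adicCompletion ℚ))
              (⨆ n, signedLocalPoints κ (w.adicCompletion ℚ) W 1 n) := fun w hw ↦
    plusLocKummer_two W hss ha hκ 0 (fun σ ↦ by rw [map_zero, sub_zero]; exact AddSubgroup.zero_mem _) w hw
  choose x2 hx2_tor hx2 using hloc2
  -- the local prescriptions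
  have hxdata : ∃ x : ∀ v : HeightOneSpectrum (𝓞 ℚ),
      discreteH1 (localSubgroup (⊤ : Subgroup (Field.absoluteGaloisGroup ℚ)) (v.adicCompletion ℚ))
        (localPoints W (v.adicCompletion ℚ)),
      ∀ v, x v = if h2 : ((2 : ℕ) : 𝓞 ℚ) ∈ v.asIdeal then x2 v h2 else xS v := ⟨_, fun _ ↦ rfl⟩
  obtain ⟨x, hx⟩ := hxdata
  have hx_tor : ∀ v, ∃ k : ℕ, 2 ^ k • x v = 0 := fun v ↦ by
    by_cases h2 : ((2 : ℕ) : 𝓞 ℚ) ∈ v.asIdeal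
    · rw [hx v, dif_pos h2]; exact hx2_tor v h2
    · rw [hx v, dif_neg h2]; exact hxS_tor v
  let xi : ∀ w : InfinitePlace ℚ,
      discreteH1 (localSubgroup (⊤ : Subgroup (Field.absoluteGaloisGroup ℚ)) w.Completion)
        (localPoints W w.Completion) := fun _ ↦ 0
  -- CASSELS
  obtain ⟨yq, hyH, hyfin, -⟩ := hC W 2 hSel hE (↑S₀ : Set (HeightOneSpectrum (𝓞 ℚ))) S₀.finite_toSet hgood x xi hx_tor
    (fun _ ↦ ⟨0, smul_zero _⟩)
  -- `res yq ∈ Sel♯_{S₀}`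
  have hres2 : ∀ w : HeightOneSpectrum (𝓞 ℚ), ((2 : ℕ) : 𝓞 ℚ) ∈ w.asIdeal →
      W.resOfLe 2 (le_top : κ.kerSubgroup ≤ ⊤) yq ∈
        localKummerOverOfEmb W 2 κ.kerSubgroup (closureEmb (K := ℚ) (w.adicCompletion ℚ))
          (⨆ n, signedLocalPoints κ (w.adicCompletion ℚ) W 1 n) := by
    intro w hw
    have h := hx2 w hw yq (by rw [hyfin w (Or.inr hw), hx w, dif_pos hw])
    rw [zero_sub] at h
    exact neg_mem_iff.mp h
  refine ⟨W.resOfLe 2 (le_top : κ.kerSubgroup ≤ ⊤) yq, ⟨?_, ?_⟩, fun v n ↦ ?_⟩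
  · exact SSFlatEC.resOfLe_mem_unramifiedOutside (W.geomPrimaryTorsion 2) (le_top : κ.kerSubgroup ≤ ⊤) 2 _ hyH
  · refine AddSubgroup.mem_iInf.mpr fun w ↦ AddSubgroup.mem_iInf.mpr fun hw ↦ AddSubgroup.mem_iInf.mpr fun σ ↦ ?_
    rw [AddSubgroup.mem_comap, SSFlatEC.conjH1_resOfLe_top W κ σ yq]
    exact hres2 w hw
  · obtain ⟨v₀, hv₀⟩ := v
    rw [SSFlatEC.conjH1_resOfLe_top W κ (γ ^ n) yq]
    -- as in the ♭ road's `exists_localLift_of_localSurj`: compose the three equalities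
    have hnat := W.localResOverOfEmb_resOfLe 2 (closureEmb (K := ℚ) (v₀.adicCompletion ℚ)) (le_top : κ.kerSubgroup ≤ ⊤) yq
    have hy' : W.localResOverOfEmb 2 ⊤ (closureEmb (K := ℚ) (v₀.adicCompletion ℚ)) yq = xS v₀ := by
      have h := hyfin v₀ (Or.inl (Finset.mem_coe.mpr hv₀))
      rw [hx v₀, dif_neg (hS₀ v₀ hv₀)] at h
      exact h
    exact hnat.trans ((congrArg _ hy').trans (hxS v₀ hv₀))


end Summit.BirchSwinnertonDyer.BirchSwinnertonDyer.Theorems.SignedEC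

end
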